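import Summits.QuantumAdvantage.AdviceFreeQNC0.AffBells22FrameIdentity
import Summits.QuantumAdvantage.AdviceFreeQNC0.AffBells22FrozenTwist
import HarnessLib

/-!
# Sketch22 §2c: `FrameAveragingOne` (frame averaging for `1`-junta tables)

`theorem frameAveragingOne : FrameAveragingOne` — a frame ⊗ junta strategy
`z_k(x) = τ_k(Vx, x)` with `1`-junta tables over a `δ`-regular frame `V` of dimension `m ≤ μ₀N`
wins the ring game on at most `3^{−m} Σ_u winCount(z^{[u]}) + ε·2^{N−1}` odd patterns, i.e. at most
`ε·2^{N−1}` more often than the average of its frozen strategies `z^{[u]}_k(x) = τ_k(u, x)`.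

Assembly: the exact frame-averaging identity / domination (`frame_domination`, Fourier inversion in the
frame variable), the error term at each non-zero frequency `t` is a normalised average over `u` of frozen
twist sums with frequency `γ = tV` (`norm_errorTerm_le`, via `norm_twist_sum_le`), `wt(tV) ≥ δN` by
regularity, and `½ · 3^m · (200/39) · (39/40)^{δN} ≤ (100/39) e^{−aN} ≤ ε` for `m ≤ (a / log 3)·N`,
`a = δ·log(40/39)/2`, `N ≥ (100/39)/(εa)`.

With `frameJuntaOfAveraging`-style reductions this is the `w₀ ≤ 1` frame-averaging input of the exit
plan (§2c of the planner's Sketch22); the general-`w₀` version `FrameAveraging` needs `Mod3VsLowDegree`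
and is not touched here.
-/

namespace Summit.QuantumAdvantage.AdviceFreeQNC0

open Finset Literature.Computability.QuantumComplexity Literature.Computability.QuantumComplexity.RingHLF
open Literature.Computability.MetaComplexity

namespace AffBells22

variable {N m : ℕ}

/-- The frame pairing is a single subset sum: `Σ_l t_l (Vx)_l = Σ_i [x_i] (tV)_i`. -/
theorem sum_mul_frameVal (t : Fin m → ZMod 3) (V : Fin m → Fin N → ZMod 3) (x : Fin N → Bool) :
    ∑ l : Fin m, t l * frameVal V x l = ∑ i : Fin N, if x i then (∑ l : Fin m, t l * V l i) else 0 := by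
  unfold frameVal
  exact TwoModuli.sum_mul_linForms_eq t V x

/-- `|𝔽₃^m| = 3^m`. -/
theorem card_frame (m : ℕ) : Fintype.card (Fin m → ZMod 3) = 3 ^ m := by
  rw [Fintype.card_fun, ZMod.card, Fintype.card_fin]

/-- **THE ERROR TERM AT FREQUENCY `t`**: `‖Σ_{x odd} Ĝ_x(t) ω^{⟨t,Vx⟩}‖ ≤ (200/39)·(39/40)^{wt(tV)}·2^{N−1}`
(expand `Ĝ_x(t) = 3^{−m} Σ_u (−1)^{⟨J(x), stake(z^{[u]},x)⟩} ω^{−⟨t,u⟩}`, swap the sums, and apply the frozen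
twist bound `norm_twist_sum_le` to each frozen strategy `z^{[u]}` with the frequency `γ = tV`). -/
theorem norm_errorTerm_le (hN : 3 ≤ N) (V : Fin m → Fin N → ZMod 3) (T : Fin N → Finset (Fin N))
    (τ : Fin N → (Fin m → ZMod 3) → (Fin N → Bool) → Bool)
    (hT : ∀ k, (T k).card ≤ 1) (hτ : ∀ k y, ReadsOnly (T k) (τ k y)) (t : Fin m → ZMod 3) :
    ‖∑ x ∈ (univ : Finset (Fin N → Bool)).filter (fun x => Fib19.IsOdd x),
        fhat m (frozenSign τ x) t * (ZMod.stdAddChar (∑ l : Fin m, t l * frameVal V x l) : ℂ)‖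
      ≤ 200 / 39 * (39 / 40 : ℝ) ^ (univ.filter fun i : Fin N => (∑ l : Fin m, t l * V l i) ≠ 0).card
          * (2 : ℝ) ^ (N - 1) := by
  set γ : Fin N → ZMod 3 := fun i => ∑ l : Fin m, t l * V l i with hγ
  set O := (univ : Finset (Fin N → Bool)).filter (fun x => Fib19.IsOdd x) with hO
  set S : (Fin m → ZMod 3) → ℂ := fun u =>
    ∑ x ∈ O, (-1 : ℂ) ^ dot2 (Fib19.kline x) (Fib19.stake (fun x k => τ k u x) x)
      * (ZMod.stdAddChar (∑ i : Fin N, if x i then γ i else 0) : ℂ) with hS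
  -- expand the Fourier coefficient and swap the sums
  have hL : ∀ x ∈ O, fhat m (frozenSign τ x) t * (ZMod.stdAddChar (∑ l : Fin m, t l * frameVal V x l) : ℂ)
      = ∑ u : Fin m → ZMod 3, ((3 : ℂ) ^ m)⁻¹ * ((ZMod.stdAddChar (-(∑ i : Fin m, t i * u i)) : ℂ) *
          ((-1 : ℂ) ^ dot2 (Fib19.kline x) (Fib19.stake (fun x k => τ k u x) x)
            * (ZMod.stdAddChar (∑ i : Fin N, if x i then γ i else 0) : ℂ))) := by
    intro x _
    unfold fhat
    rw [mul_sum, sum_mul]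
    refine sum_congr rfl fun u _ => ?_
    rw [sum_mul_frameVal]
    unfold frozenSign frozenBell
    ring
  have hexp : ∑ x ∈ O, fhat m (frozenSign τ x) t * (ZMod.stdAddChar (∑ l : Fin m, t l * frameVal V x l) : ℂ)
      = ((3 : ℂ) ^ m)⁻¹ * ∑ u : Fin m → ZMod 3, (ZMod.stdAddChar (-(∑ i : Fin m, t i * u i)) : ℂ) * S u := by
    rw [sum_congr rfl hL, sum_comm, mul_sum]
    refine sum_congr rfl fun u _ => ?_
    rw [hS, mul_sum, mul_sum]
  have hin : ∀ u : Fin m → ZMod 3, ‖(ZMod.stdAddChar (-(∑ i : Fin m, t i * u i)) : ℂ) * S u‖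
      ≤ 200 / 39 * (39 / 40 : ℝ) ^ (univ.filter fun i : Fin N => γ i ≠ 0).card * (2 : ℝ) ^ (N - 1) := by
    intro u
    rw [norm_mul, AffBells21.norm_stdAddChar_three, one_mul]
    exact norm_twist_sum_le hN T (fun k => τ k u) hT (fun k => hτ k u) γ
  rw [hexp, norm_mul, norm_inv, norm_pow]
  have h3 : ‖(3 : ℂ)‖ = 3 := by simp
  rw [h3]
  have h3pos : (0 : ℝ) < (3 : ℝ) ^ m := by positivity
  calc ((3 : ℝ) ^ m)⁻¹ * ‖∑ u : Fin m → ZMod 3, (ZMod.stdAddChar (-(∑ i : Fin m, t i * u i)) : ℂ) * S u‖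
      ≤ ((3 : ℝ) ^ m)⁻¹ * ∑ u : Fin m → ZMod 3, ‖(ZMod.stdAddChar (-(∑ i : Fin m, t i * u i)) : ℂ) * S u‖ := by
        gcongr; exact norm_sum_le _ _
    _ ≤ ((3 : ℝ) ^ m)⁻¹ * ∑ _u : Fin m → ZMod 3,
          (200 / 39 * (39 / 40 : ℝ) ^ (univ.filter fun i : Fin N => γ i ≠ 0).card * (2 : ℝ) ^ (N - 1)) := by
        gcongr with u _; exact hin u
    _ = 200 / 39 * (39 / 40 : ℝ) ^ (univ.filter fun i : Fin N => γ i ≠ 0).card * (2 : ℝ) ^ (N - 1) := by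
        rw [sum_const, card_univ, card_frame, nsmul_eq_mul]
        push_cast
        field_simp

/-- `exp(−s) ≤ 1/(s+1)` for `s ≥ 0`. -/
theorem exp_neg_le_one_div {s : ℝ} (hs : 0 ≤ s) : Real.exp (-s) ≤ 1 / (s + 1) := by
  rw [Real.exp_neg, inv_eq_one_div]
  exact one_div_le_one_div_of_le (by linarith) (Real.add_one_le_exp s)

/-- **FRAME AVERAGING, `w₀ ≤ 1`** (Sketch22 §2c, `FrameAveragingOne`): a frame ⊗ `1`-junta strategy over a `δ`-regular frame of
dimension `m ≤ μ₀N` wins at most `ε·2^{N−1}` more often than the average of its `3^m` frozen strategies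
(`μ₀ = δ·log(40/39)/(2·log 3)`).  Proof: `frame_domination` + `norm_errorTerm_le` + `3^m·(39/40)^{δN} ≤ e^{−aN}`,
`a = δ·log(40/39)/2`. -/
theorem frameAveragingOne : FrameAveragingOne := by
  intro δ hδ ε hε
  have hlog : 0 < Real.log (40 / 39) := Real.log_pos (by norm_num)
  have hlog3 : 0 < Real.log 3 := Real.log_pos (by norm_num)
  set a : ℝ := δ * Real.log (40 / 39) / 2 with ha
  have ha0 : 0 < a := by positivity
  refine ⟨a / Real.log 3, by positivity, max 3 ⌈(100 / 39) / (ε * a)⌉₊, fun N hN m hm V T τ hV hT hτ => ?_⟩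
  have hN3 : 3 ≤ N := le_trans (le_max_left _ _) hN
  have hNceil : (100 / 39) / (ε * a) ≤ N :=
    le_trans (Nat.le_ceil _) (by exact_mod_cast le_trans (le_max_right _ _) hN)
  refine (frame_domination hN3 V τ).trans (add_le_add le_rfl ?_)
  -- each error term
  have hterm : ∀ t ∈ (univ : Finset (Fin m → ZMod 3)).erase 0,
      ‖∑ x ∈ (univ : Finset (Fin N → Bool)).filter (fun x => Fib19.IsOdd x),
          fhat m (frozenSign τ x) t * (ZMod.stdAddChar (∑ l : Fin m, t l * frameVal V x l) : ℂ)‖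
        ≤ 200 / 39 * Real.exp (-(2 * a * N)) * (2 : ℝ) ^ (N - 1) := by
    intro t ht
    have ht0 : t ≠ 0 := (mem_erase.mp ht).1
    refine (norm_errorTerm_le hN3 V T τ hT hτ t).trans ?_
    have hwt := hV t ht0
    have hk : (39 / 40 : ℝ) ^ (univ.filter fun i : Fin N => (∑ l : Fin m, t l * V l i) ≠ 0).card
        ≤ Real.exp (-(2 * a * N)) := by
      rw [← Real.exp_log (show (0 : ℝ) < 39 / 40 by norm_num), ← Real.exp_nat_mul, Real.exp_le_exp]
      have hl : Real.log (39 / 40) = -Real.log (40 / 39) := by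
        rw [← Real.log_inv]; norm_num
      rw [hl, ha]
      have := mul_le_mul_of_nonneg_right hwt hlog.le
      linarith
    gcongr
  -- the number of error terms and the frame dimension
  have hcard : (((univ : Finset (Fin m → ZMod 3)).erase 0).card : ℝ) ≤ (3 : ℝ) ^ m := by
    have h : ((univ : Finset (Fin m → ZMod 3)).erase 0).card ≤ 3 ^ m := by
      rw [card_erase_of_mem (mem_univ _), card_univ, card_frame]; exact Nat.sub_le _ _
    exact_mod_cast h
  have h3m : (3 : ℝ) ^ m ≤ Real.exp (a * N) := by
    have : (3 : ℝ) ^ m = Real.exp (m * Real.log 3) := by rw [Real.exp_nat_mul, Real.exp_log (by norm_num)]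
    rw [this, Real.exp_le_exp]
    calc (m : ℝ) * Real.log 3 ≤ a / Real.log 3 * N * Real.log 3 := mul_le_mul_of_nonneg_right hm hlog3.le
      _ = a * N := by field_simp
  have hfin : 100 / 39 * Real.exp (-(a * N)) ≤ ε := by
    have h1 := exp_neg_le_one_div (s := a * N) (by positivity)
    have h2 : 100 / 39 ≤ ε * a * N := by
      rw [div_le_iff₀ (by positivity)] at hNceil; linarith
    calc 100 / 39 * Real.exp (-(a * N)) ≤ 100 / 39 * (1 / (a * N + 1)) := by gcongr
      _ ≤ ε := by
          rw [← mul_div_assoc, mul_one, div_le_iff₀ (by positivity)]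
          nlinarith [hε.le]
  have h2N : (0 : ℝ) ≤ (2 : ℝ) ^ (N - 1) := by positivity
  calc (1 / 2 : ℝ) * ∑ t ∈ (univ : Finset (Fin m → ZMod 3)).erase 0,
          ‖∑ x ∈ (univ : Finset (Fin N → Bool)).filter (fun x => Fib19.IsOdd x),
            fhat m (frozenSign τ x) t * (ZMod.stdAddChar (∑ l : Fin m, t l * frameVal V x l) : ℂ)‖
      ≤ (1 / 2 : ℝ) * ∑ _t ∈ (univ : Finset (Fin m → ZMod 3)).erase 0,
          (200 / 39 * Real.exp (-(2 * a * N)) * (2 : ℝ) ^ (N - 1)) :=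
        mul_le_mul_of_nonneg_left (sum_le_sum hterm) (by norm_num)
    _ = (1 / 2 : ℝ) * ((((univ : Finset (Fin m → ZMod 3)).erase 0).card : ℝ)
          * (200 / 39 * Real.exp (-(2 * a * N)) * (2 : ℝ) ^ (N - 1))) := by rw [sum_const, nsmul_eq_mul]
    _ ≤ (1 / 2 : ℝ) * ((3 : ℝ) ^ m * (200 / 39 * Real.exp (-(2 * a * N)) * (2 : ℝ) ^ (N - 1))) := by gcongr
    _ ≤ (1 / 2 : ℝ) * (Real.exp (a * N) * (200 / 39 * Real.exp (-(2 * a * N)) * (2 : ℝ) ^ (N - 1))) := by gcongr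
    _ = 100 / 39 * (Real.exp (a * N) * Real.exp (-(2 * a * N))) * (2 : ℝ) ^ (N - 1) := by ring
    _ = 100 / 39 * Real.exp (-(a * N)) * (2 : ℝ) ^ (N - 1) := by
        rw [← Real.exp_add]; congr 2; ring_nf
    _ ≤ ε * (2 : ℝ) ^ (N - 1) := mul_le_mul_of_nonneg_right hfin h2N

end AffBells22

end Summit.QuantumAdvantage.AdviceFreeQNC0
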